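import Summits.QuantumFields.QCD.Theses.FourMirrorsWardE1
import Summits.QuantumFields.QCD.Theses.TransparentRPWall
import Summits.QuantumFields.QCD.Theorems.GapBuysCauchyRateCauchySummation
import Summits.QuantumFields.QCD.Theorems.GapBuysCauchyRateConvergentOSClosureStubSoftClosure
import Summits.QuantumFields.QCD.Theorems.GapBuysCauchyRateConvergentOSClosureStubAsymptoticTranslation
import Summits.QuantumFields.QCD.Theorems.GapBuysCauchyRateRotationRestorationLatticeInvariancePassesToLimit
import HarnessLib

/-!
# `FourMirrorsWardE1.HonestLatticeLimit` (stmt-QuantumFields-18092) BY NAME from the three sub-statements of the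
# strategist line `ladder_bridge` — the kernel-checked SPLIT glue (crux-strategist `cstrat-stmt-QuantumFields-18092-s1`)

`honestLatticeLimit_of_ladderCauchyRate_of_tightness_of_remnant : Sub₁ → Sub₂ → Sub₃ → HonestLatticeLimit`
(and the `TransparentRPWall` copy of the crux, whose body is identical), where

* `Sub₁` (LCR) is VERBATIM the statement of `Summit.QuantumFields.QCD.Theses.GapBuysCauchyRate.LadderCauchyRate`
  (item stmt-QuantumFields-17307, the rank-2 crux of route `route-QuantumFields-GapBuysCauchyRate`; inlined rather than
  imported so that this file does not depend on that route file): for `N_f = 2, 3` one mass-scaling regularisation,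
  asymptotically free, CHIRAL AT ZERO, carrying a calibrated species family `𝒞` whose honest lattice `n`-point functions
  are, for every positive mass tuple, on the physical branch, uniformly gapped, calibrated (glue and `pseudoRe f g`,
  `f ≠ g`), with a `κ₃` floor, and CAUCHY in `k` with a summable envelope on off-diagonal real tensors;
* `Sub₂` (T) is VERBATIM the registered stub `stub_tightness` of the sibling crux `ConvergentOSClosure`
  (stmt-QuantumFields-11525): the k-uniform E0′ bound (`UV tightness`) on `⁰𝒮` along a convergent calibrated gapped
  asymptotically free ladder;
* `Sub₃` (HYP) is the hypercubic REMNANT of Euclidean invariance at finite lattice spacing made asymptotic: along the same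
  ladder, given the E0′ bound, `Λ_k(F ∘ R⁻¹) − Λ_k(F) → 0` on `⁰𝒮` for every proper signed permutation `R` of the axes
  (`Λ_k = qcdLatticeDist (𝒞.scheme m) k`), cf. Montvay–Münster 1994 §4.2 (reflections in lattice planes, rotations by
  `π/2`), typed exactly like the landed `stub_asymptoticTranslation`.

This file contains NO `def`: the three hypotheses are written out, so that a planner can file the route-level split
`HonestLatticeLimit ← LadderCauchyRate, CalibratedTightness, DiscreteRemnant` with `--glue-by` this theorem, and the
skeleton `Cruxes/HonestLatticeLimit/Lines/ladder_bridge.lean` (whose registered stub signatures are these three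
statements) concludes the crux through it.

Proof (bookkeeping over LANDED theorems; standard axioms): Cauchy + summable ⇒ convergence on off-diagonal real tensors
(`cauchySummation_proof`); T ⇒ the k-uniform E0′ bound; the landed `ConvergentOSClosure.stub_asymptoticTranslation` ⇒
asymptotic translation invariance; HYP ⇒ asymptotic hypercubic invariance; density of off-diagonal tensors + E0′
equicontinuity ⇒ convergence on all of `⁰𝒮` (`tendsto_qcdLatticeDist_of_tensor`, `stub_offDiagonalTensorDensity`);
Hahn–Banach limit family (`exists_labelled_tendsto`) and inheritance of E0 (`isNormalized_of_labelled_tendsto`), E0′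
(`hasLinearGrowth_of_labelled_bound`), translations (`translate_eq_of_labelled_tendsto`), E3 (`stub_permExact`,
`isSymmetric_of_labelled_tendsto`) and the hypercubic remnant (uniqueness of limits, `isOffDiagonal_linActMulti`);
asymptotic freedom, the physical branch, the lattice gap and chirality at zero are READ OFF `Sub₁` (`HasAsymptoticScaling`
reads only `β, a`; `𝒞.scheme m = reg.scheme m (𝒞.z m) (𝒞.shift m)` definitionally); non-triviality of glue and of
`pseudoRe f g` from the calibration and the calibrated one-point subtraction (`nt_of_calibration`), non-Gaussianity of glue
from the `κ₃` floor (`ng_of_kappa₃`) — the S-level versions of the landed `stub_speciesPackaging` (Osterwalder–Schrader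
1975 §4; Glimm–Jaffe 1987 §6.1), re-proved here because the crux's `S` carries no OS axioms.

Nothing here proves physics: Sub₁ (= stmt-17307, open problem), Sub₂ (UV tightness, open) and Sub₃ (provable with work)
are hypotheses.  What the file certifies is that they are JOINTLY SUFFICIENT for the existence half of QCD as typed by
both bet routes.
-/

noncomputable section

namespace Summit.QuantumFields.QCD.Theorems.HonestLatticeLimitSplit

open scoped BigOperators Topology SchwartzMap ComplexConjugate
open MeasureTheory Filter
open Literature.MathematicalPhysics.AQFT Literature.MathematicalPhysics.QuantumLattice
  Literature.MathematicalPhysics.QuantumFieldTheory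
open Summit.QuantumFields.QCD.Cruxes.StableActionBridge.Sketch
open Summit.QuantumFields.QCD.Cruxes.RotationRestoration.Birth.LatticeInvariancePassesToLimit
  (isOffDiagonal_linActMulti)

/-! ## §1 Tools (S-level versions of the landed packaging lemmas of `ConvergentOSClosure`) -/

/-- A point of the support of the tensor `⊗ᵢ fᵢ` of real test functions has every coordinate in the support of the
corresponding factor. -/
private theorem mem_tsupport_factor {n : ℕ} (f : Fin n → 𝓢((EuclideanSpace ℝ (Fin 4)), ℝ)) {x : Fin n → (EuclideanSpace ℝ (Fin 4))}
    (hx : x ∈ tsupport ((SchwartzMap.tensorFin n fun i => ofRealTest (f i)) : (Fin n → (EuclideanSpace ℝ (Fin 4))) → ℂ))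
    (i : Fin n) : x i ∈ tsupport (f i : (EuclideanSpace ℝ (Fin 4)) → ℝ) := by
  by_contra hi
  have h1 : ∀ᶠ y in 𝓝 x, f i (y i) = 0 :=
    ((continuous_apply i).tendsto x).eventually (notMem_tsupport_iff_eventuallyEq.mp hi)
  refine (notMem_tsupport_iff_eventuallyEq.mpr ?_) hx
  filter_upwards [h1] with y hy
  simp only [Pi.zero_apply, SchwartzMap.tensorFin_apply, ofRealTest_apply]
  exact Finset.prod_eq_zero (Finset.mem_univ i) (by rw [hy]; simp)

/-- Support criterion for tensors: pairwise disjoint supports ⇒ `⊗ᵢ fᵢ ∈ ⁰𝒮`. -/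
private theorem isOffDiagonal_tensorFin {n : ℕ} (f : Fin n → 𝓢((EuclideanSpace ℝ (Fin 4)), ℝ))
    (hsep : ∀ i j, i ≠ j → ∀ z, z ∈ tsupport (f i : (EuclideanSpace ℝ (Fin 4)) → ℝ) → z ∈ tsupport (f j : (EuclideanSpace ℝ (Fin 4)) → ℝ) → False) :
    IsOffDiagonal (SchwartzMap.tensorFin n fun i => ofRealTest (f i)) :=
  IsOffDiagonal.of_tsupport_subset fun x hx hmem => by
    obtain ⟨i, j, hij, hxij⟩ := hmem
    exact hsep i j hij (x i) (mem_tsupport_factor f hx i) (hxij ▸ mem_tsupport_factor f hx j)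

/-- A one-fold tensor is off-diagonal (there are no pairs of distinct indices). -/
private theorem isOffDiagonal_tensorFin_one (a : 𝓢((EuclideanSpace ℝ (Fin 4)), ℝ)) :
    IsOffDiagonal (SchwartzMap.tensorFin 1 fun i => ofRealTest ((![a] : Fin 1 → _) i)) :=
  isOffDiagonal_tensorFin ![a] fun i j hij _ _ _ => hij (Subsingleton.elim i j)

/-- A two-fold tensor of real test functions with disjoint supports is off-diagonal. -/
private theorem isOffDiagonal_tensorFin_two (a b : 𝓢((EuclideanSpace ℝ (Fin 4)), ℝ))
    (hab : ∀ z, z ∈ tsupport (a : (EuclideanSpace ℝ (Fin 4)) → ℝ) → z ∈ tsupport (b : (EuclideanSpace ℝ (Fin 4)) → ℝ) → False) :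
    IsOffDiagonal (SchwartzMap.tensorFin 2 fun i => ofRealTest ((![a, b] : Fin 2 → _) i)) := by
  refine isOffDiagonal_tensorFin ![a, b] fun i j hij z hzi hzj => ?_
  fin_cases i <;> fin_cases j
  · exact hij rfl
  · exact hab z hzi hzj
  · exact hab z hzj hzi
  · exact hij rfl

/-- A one-fold tensor supported in `{x⁰ > 0}` is time-ordered. -/
private theorem isTimeOrdered_tensorFin_one (g : 𝓢((EuclideanSpace ℝ (Fin 4)), ℝ)) (hg : tsupport (g : (EuclideanSpace ℝ (Fin 4)) → ℝ) ⊆ {x | 0 < x 0}) :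
    IsTimeOrdered (SchwartzMap.tensorFin 1 fun i => ofRealTest ((![g] : Fin 1 → _) i)) := by
  intro x hx
  refine ⟨fun i => ?_, fun i j hij => absurd (Fin.lt_def.mp hij) (by omega)⟩
  have h := mem_tsupport_factor ![g] hx i
  simp only [Matrix.cons_val_fin_one] at h
  exact hg h

/-- The OS adjoint of the one-fold tensor of `Θa` is the one-fold tensor of `a` (real test functions). -/
private theorem osAdjoint_tensorFin_one_thetaTest (a : 𝓢((EuclideanSpace ℝ (Fin 4)), ℝ)) :
    osAdjoint (SchwartzMap.tensorFin 1 fun i => ofRealTest ((![thetaTest 4 a] : Fin 1 → _) i)) =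
      SchwartzMap.tensorFin 1 fun i => ofRealTest ((![a] : Fin 1 → _) i) := by
  ext x
  rw [osAdjoint_apply]
  simp [SchwartzMap.tensorFin_apply, thetaTest_apply, timeReflection_timeReflection]

/-- The OS adjoint of the one-fold tensor of `a` is the one-fold tensor of `Θa` (real test functions). -/
private theorem osAdjoint_tensorFin_one (a : 𝓢((EuclideanSpace ℝ (Fin 4)), ℝ)) :
    osAdjoint (SchwartzMap.tensorFin 1 fun i => ofRealTest ((![a] : Fin 1 → _) i)) =
      SchwartzMap.tensorFin 1 fun i => ofRealTest ((![thetaTest 4 a] : Fin 1 → _) i) := by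
  have h := osAdjoint_tensorFin_one_thetaTest (thetaTest 4 a)
  rwa [thetaTest_involutive 4 a] at h

/-- `a ⊗ b` is the append-tensor of the one-fold tensors of `a` and `b`. -/
private theorem isAppendTensorOf_tensorFin_two (a b : 𝓢((EuclideanSpace ℝ (Fin 4)), ℝ)) :
    IsAppendTensorOf (n := 1) (m := 1)
      (SchwartzMap.tensorFin 2 fun i => ofRealTest ((![a, b] : Fin 2 → _) i))
      (SchwartzMap.tensorFin 1 fun i => ofRealTest ((![a] : Fin 1 → _) i))
      (SchwartzMap.tensorFin 1 fun i => ofRealTest ((![b] : Fin 1 → _) i)) := by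
  intro x
  simp [SchwartzMap.tensorFin_apply, Fin.prod_univ_two]

/-- `![s]` is the constant label vector. -/
private theorem vec_one_eq_const {ι : Type} (s : ι) : (![s] : Fin 1 → ι) = fun _ => s := by
  funext i; fin_cases i; rfl

/-- `![s, s]` is the constant label vector. -/
private theorem vec_two_eq_const {ι : Type} (s : ι) : (![s, s] : Fin 2 → ι) = fun _ => s := by
  funext i; fin_cases i <;> rfl

/-- `![s, s, s]` is the constant label vector. -/
private theorem vec_three_eq_const {ι : Type} (s : ι) : (![s, s, s] : Fin 3 → ι) = fun _ => s := by
  funext i; fin_cases i <;> rfl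

/-- **Non-triviality at the level of the limit family `S` (no OS axioms needed)**: if the calibrating two-point
function of species `s` is eventually `1` and `S` is the limit of the calibrated lattice `n`-point functions on real
tensors in `⁰𝒮`, then `S₂^{ss}(Θf₀ ⊗ f₀) = 1 ≠ 0 = S₁^{s}(Θf₀) S₁^{s}(f₀)` — the `NT` clause of `HonestLatticeLimit`. [folklore] (Osterwalder–Schrader 1975 §4: the calibrated two-point value passes
to the limit; Glimm–Jaffe 1987 §6.1.) -/
theorem nt_of_calibration {Nf : ℕ} {reg : QCDRegularisation Nf}
    (𝒞 : CalibratedSpeciesFamily reg) (m : Fin Nf → ℝ) (s : QCDField Nf)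
    (hcal : ∀ᶠ k in Filter.atTop, (𝒞.scheme m).twoPoint k s s (thetaTest 4 𝒞.f₀) 𝒞.f₀ = 1)
    (S : LabelledSchwingerFamily (QCDField Nf) (EuclideanSpace ℝ (Fin 4)))
    (hlim : ∀ n : ℕ, n ≠ 0 → ∀ (σ : Fin n → QCDField Nf) (f : Fin n → 𝓢((EuclideanSpace ℝ (Fin 4)), ℝ)) (F : 𝓢((Fin n → (EuclideanSpace ℝ (Fin 4))), ℂ)),
      IsTensorOf F (fun i => ofRealTest (f i)) → IsOffDiagonal F →
        Filter.Tendsto (fun k : ℕ => qcdLatticeSchwinger (𝒞.scheme m) k n σ f) Filter.atTop (nhds (S n σ F))) :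
    ∃ (F G : 𝓢((Fin 1 → (EuclideanSpace ℝ (Fin 4))), ℂ)) (H : 𝓢((Fin (1 + 1) → (EuclideanSpace ℝ (Fin 4))), ℂ)),
      IsTimeOrdered F ∧ IsTimeOrdered G ∧ IsAppendTensorOf H (osAdjoint F) G ∧
        S (1 + 1) (fun _ => s) H ≠ S 1 (fun _ => s) (osAdjoint F) * S 1 (fun _ => s) G := by
  have hpos : tsupport (𝒞.f₀ : (EuclideanSpace ℝ (Fin 4)) → ℝ) ⊆ {x | 0 < x 0} := fun x hx => by
    have h := (mem_timeSlab.1 (𝒞.tsupport_f₀ hx)).1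
    simp only [Set.mem_setOf_eq]
    linarith [𝒞.τ₀_pos]
  have hsep : ∀ z, z ∈ tsupport (thetaTest 4 𝒞.f₀ : (EuclideanSpace ℝ (Fin 4)) → ℝ) → z ∈ tsupport (𝒞.f₀ : (EuclideanSpace ℝ (Fin 4)) → ℝ) → False :=
    fun z h₁ h₂ => Set.disjoint_left.1 𝒞.disjoint_tsupport h₁ h₂
  have h2 : Filter.Tendsto (fun k : ℕ => qcdLatticeSchwinger (𝒞.scheme m) k 2 ![s, s] ![thetaTest 4 𝒞.f₀, 𝒞.f₀])
      Filter.atTop (nhds (S 2 ![s, s] (SchwartzMap.tensorFin 2 fun i =>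
        ofRealTest ((![thetaTest 4 𝒞.f₀, 𝒞.f₀] : Fin 2 → _) i)))) :=
    hlim 2 two_ne_zero _ _ _ (isTensorOf_tensorFin _) (isOffDiagonal_tensorFin_two _ _ hsep)
  have h2' : Filter.Tendsto (fun k : ℕ => qcdLatticeSchwinger (𝒞.scheme m) k 2 ![s, s] ![thetaTest 4 𝒞.f₀, 𝒞.f₀])
      Filter.atTop (nhds 1) :=
    tendsto_const_nhds.congr' (hcal.mono fun k hk => by
      rw [QCDScheme.twoPoint_eq] at hk
      exact hk.symm)
  have hval2 := tendsto_nhds_unique h2 h2'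
  rw [vec_two_eq_const s] at hval2
  have h1 : Filter.Tendsto (fun k : ℕ => qcdLatticeSchwinger (𝒞.scheme m) k 1 ![s] ![𝒞.f₀]) Filter.atTop
      (nhds (S 1 ![s] (SchwartzMap.tensorFin 1 fun i => ofRealTest ((![𝒞.f₀] : Fin 1 → _) i)))) :=
    hlim 1 one_ne_zero _ _ _ (isTensorOf_tensorFin _) (isOffDiagonal_tensorFin_one _)
  have h1' : Filter.Tendsto (fun k : ℕ => qcdLatticeSchwinger (𝒞.scheme m) k 1 ![s] ![𝒞.f₀]) Filter.atTop (nhds 0) := by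
    have h0 : (fun k : ℕ => qcdLatticeSchwinger (𝒞.scheme m) k 1 ![s] ![𝒞.f₀]) = fun _ => 0 := by
      funext k
      rw [vec_one_eq_const s, vec_one_eq_const 𝒞.f₀]
      exact 𝒞.onePoint_eq_zero m s k 𝒞.f₀
    rw [h0]
    exact tendsto_const_nhds
  have hval1 := tendsto_nhds_unique h1 h1'
  rw [vec_one_eq_const s] at hval1
  refine ⟨SchwartzMap.tensorFin 1 fun i => ofRealTest ((![𝒞.f₀] : Fin 1 → _) i),
    SchwartzMap.tensorFin 1 fun i => ofRealTest ((![𝒞.f₀] : Fin 1 → _) i),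
    SchwartzMap.tensorFin 2 fun i => ofRealTest ((![thetaTest 4 𝒞.f₀, 𝒞.f₀] : Fin 2 → _) i),
    isTimeOrdered_tensorFin_one _ hpos, isTimeOrdered_tensorFin_one _ hpos, ?_, ?_⟩
  · rw [osAdjoint_tensorFin_one]
    exact isAppendTensorOf_tensorFin_two _ _
  · rw [osAdjoint_tensorFin_one]
    change S 2 (fun _ => s) _ ≠ S 1 (fun _ => s) _ * S 1 (fun _ => s) _
    rw [hval2, hval1, mul_zero]
    exact one_ne_zero

/-- **Non-Gaussianity at the level of the limit family `S`** from the lattice `κ₃` witness of species `s` (real bumps in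
the pairwise disjoint slabs `x⁰ < 0`, `0 < x⁰ < 1`, `1 < x⁰` whose lattice connected three-point combination stays
`≥ ε > 0` eventually) and the limit clause — the `NG` clause of `HonestLatticeLimit`. [folklore] (limits preserve the connected three-point
combination; Glimm–Jaffe 1987 §6.1.) -/
theorem ng_of_kappa₃ {Nf : ℕ} (sch : QCDScheme Nf) (s : QCDField Nf)
    (hw : ∃ f g h : 𝓢((EuclideanSpace ℝ (Fin 4)), ℝ),
      tsupport (f : (EuclideanSpace ℝ (Fin 4)) → ℝ) ⊆ {x | x 0 < 0} ∧ tsupport (g : (EuclideanSpace ℝ (Fin 4)) → ℝ) ⊆ {x | 0 < x 0 ∧ x 0 < 1} ∧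
      tsupport (h : (EuclideanSpace ℝ (Fin 4)) → ℝ) ⊆ {x | 1 < x 0} ∧
      ∃ ε > (0 : ℝ), ∀ᶠ k in Filter.atTop, ε ≤ ‖qcdLatticeSchwinger sch k 3 ![s, s, s] ![f, g, h] -
        qcdLatticeSchwinger sch k 1 ![s] ![f] * qcdLatticeSchwinger sch k 2 ![s, s] ![g, h] -
        qcdLatticeSchwinger sch k 1 ![s] ![g] * qcdLatticeSchwinger sch k 2 ![s, s] ![f, h] -
        qcdLatticeSchwinger sch k 1 ![s] ![h] * qcdLatticeSchwinger sch k 2 ![s, s] ![f, g] +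
        2 * (qcdLatticeSchwinger sch k 1 ![s] ![f] * qcdLatticeSchwinger sch k 1 ![s] ![g] *
          qcdLatticeSchwinger sch k 1 ![s] ![h])‖)
    (S : LabelledSchwingerFamily (QCDField Nf) (EuclideanSpace ℝ (Fin 4)))
    (hlim : ∀ n : ℕ, n ≠ 0 → ∀ (σ : Fin n → QCDField Nf) (f : Fin n → 𝓢((EuclideanSpace ℝ (Fin 4)), ℝ)) (F : 𝓢((Fin n → (EuclideanSpace ℝ (Fin 4))), ℂ)),
      IsTensorOf F (fun i => ofRealTest (f i)) → IsOffDiagonal F →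
        Filter.Tendsto (fun k : ℕ => qcdLatticeSchwinger sch k n σ f) Filter.atTop (nhds (S n σ F))) :
    ∃ (f g h : 𝓢((EuclideanSpace ℝ (Fin 4)), ℂ)) (Ffgh : 𝓢((Fin 3 → (EuclideanSpace ℝ (Fin 4))), ℂ)) (Fgh Ffh Ffg : 𝓢((Fin 2 → (EuclideanSpace ℝ (Fin 4))), ℂ))
      (Ff Fg Fh : 𝓢((Fin 1 → (EuclideanSpace ℝ (Fin 4))), ℂ)),
      IsTensorOf Ffgh ![f, g, h] ∧ IsOffDiagonal Ffgh ∧ IsTensorOf Fgh ![g, h] ∧ IsTensorOf Ffh ![f, h] ∧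
      IsTensorOf Ffg ![f, g] ∧ IsTensorOf Ff ![f] ∧ IsTensorOf Fg ![g] ∧ IsTensorOf Fh ![h] ∧
      S 3 (fun _ => s) Ffgh - S 1 (fun _ => s) Ff * S 2 (fun _ => s) Fgh - S 1 (fun _ => s) Fg * S 2 (fun _ => s) Ffh -
        S 1 (fun _ => s) Fh * S 2 (fun _ => s) Ffg +
        2 * (S 1 (fun _ => s) Ff * S 1 (fun _ => s) Fg * S 1 (fun _ => s) Fh) ≠ 0 := by
  obtain ⟨f, g, h, hf, hg, hh, ε, hε, hev⟩ := hw
  have hsl : ∀ (a b : 𝓢((EuclideanSpace ℝ (Fin 4)), ℝ)) (P Q : ℝ → Prop),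
      tsupport (a : (EuclideanSpace ℝ (Fin 4)) → ℝ) ⊆ {x | P (x 0)} → tsupport (b : (EuclideanSpace ℝ (Fin 4)) → ℝ) ⊆ {x | Q (x 0)} →
      (∀ t, P t → Q t → False) → ∀ z, z ∈ tsupport (a : (EuclideanSpace ℝ (Fin 4)) → ℝ) → z ∈ tsupport (b : (EuclideanSpace ℝ (Fin 4)) → ℝ) → False :=
    fun a b P Q ha hb hPQ z h1 h2 => hPQ _ (ha h1) (hb h2)
  have hfg := hsl f g (· < 0) (fun t => 0 < t ∧ t < 1) hf hg fun t a b => by linarith [b.1]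
  have hfh := hsl f h (· < 0) (1 < ·) hf hh fun t a b => by linarith
  have hgh := hsl g h (fun t => 0 < t ∧ t < 1) (1 < ·) hg hh fun t a b => by linarith [a.2]
  have h3off : IsOffDiagonal (SchwartzMap.tensorFin 3 fun i => ofRealTest ((![f, g, h] : Fin 3 → _) i)) := by
    refine isOffDiagonal_tensorFin ![f, g, h] fun i j hij z hzi hzj => ?_
    fin_cases i <;> fin_cases j
    · exact hij rfl
    · exact hfg z hzi hzj
    · exact hfh z hzi hzj
    · exact hfg z hzj hzi
    · exact hij rfl
    · exact hgh z hzi hzj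
    · exact hfh z hzj hzi
    · exact hgh z hzj hzi
    · exact hij rfl
  have L3 : Filter.Tendsto (fun k => qcdLatticeSchwinger sch k 3 ![s, s, s] ![f, g, h]) Filter.atTop
      (nhds (S 3 ![s, s, s] (SchwartzMap.tensorFin 3 fun i => ofRealTest ((![f, g, h] : Fin 3 → _) i)))) :=
    hlim 3 (by norm_num) ![s, s, s] ![f, g, h] _ (isTensorOf_tensorFin _) h3off
  have L2 : ∀ a b : 𝓢((EuclideanSpace ℝ (Fin 4)), ℝ), (∀ z, z ∈ tsupport (a : (EuclideanSpace ℝ (Fin 4)) → ℝ) → z ∈ tsupport (b : (EuclideanSpace ℝ (Fin 4)) → ℝ) → False) →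
      Filter.Tendsto (fun k => qcdLatticeSchwinger sch k 2 ![s, s] ![a, b]) Filter.atTop
        (nhds (S 2 ![s, s] (SchwartzMap.tensorFin 2 fun i => ofRealTest ((![a, b] : Fin 2 → _) i)))) :=
    fun a b hab => hlim 2 two_ne_zero ![s, s] ![a, b] _ (isTensorOf_tensorFin _) (isOffDiagonal_tensorFin_two a b hab)
  have L1 : ∀ a : 𝓢((EuclideanSpace ℝ (Fin 4)), ℝ), Filter.Tendsto (fun k => qcdLatticeSchwinger sch k 1 ![s] ![a]) Filter.atTop
      (nhds (S 1 ![s] (SchwartzMap.tensorFin 1 fun i => ofRealTest ((![a] : Fin 1 → _) i)))) :=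
    fun a => hlim 1 one_ne_zero ![s] ![a] _ (isTensorOf_tensorFin _) (isOffDiagonal_tensorFin_one a)
  have hlim' := (((L3.sub ((L1 f).mul (L2 g h hgh))).sub ((L1 g).mul (L2 f h hfh))).sub
    ((L1 h).mul (L2 f g hfg))).add ((((L1 f).mul (L1 g)).mul (L1 h)).const_mul 2)
  have hle := ge_of_tendsto hlim'.norm hev
  have hne : S 3 ![s, s, s] (SchwartzMap.tensorFin 3 fun i => ofRealTest ((![f, g, h] : Fin 3 → _) i))
      - S 1 ![s] (SchwartzMap.tensorFin 1 fun i => ofRealTest ((![f] : Fin 1 → _) i)) *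
        S 2 ![s, s] (SchwartzMap.tensorFin 2 fun i => ofRealTest ((![g, h] : Fin 2 → _) i))
      - S 1 ![s] (SchwartzMap.tensorFin 1 fun i => ofRealTest ((![g] : Fin 1 → _) i)) *
        S 2 ![s, s] (SchwartzMap.tensorFin 2 fun i => ofRealTest ((![f, h] : Fin 2 → _) i))
      - S 1 ![s] (SchwartzMap.tensorFin 1 fun i => ofRealTest ((![h] : Fin 1 → _) i)) *
        S 2 ![s, s] (SchwartzMap.tensorFin 2 fun i => ofRealTest ((![f, g] : Fin 2 → _) i))
      + 2 * (S 1 ![s] (SchwartzMap.tensorFin 1 fun i => ofRealTest ((![f] : Fin 1 → _) i)) *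
          S 1 ![s] (SchwartzMap.tensorFin 1 fun i => ofRealTest ((![g] : Fin 1 → _) i)) *
          S 1 ![s] (SchwartzMap.tensorFin 1 fun i => ofRealTest ((![h] : Fin 1 → _) i))) ≠ 0 := by
    intro h0
    rw [h0, norm_zero] at hle
    linarith
  rw [vec_three_eq_const s, vec_two_eq_const s, vec_one_eq_const s] at hne
  have hT : ∀ {n : ℕ} (u : Fin n → 𝓢((EuclideanSpace ℝ (Fin 4)), ℝ)) (uc : Fin n → 𝓢((EuclideanSpace ℝ (Fin 4)), ℂ)), (∀ i, uc i = ofRealTest (u i)) →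
      IsTensorOf (SchwartzMap.tensorFin n fun i => ofRealTest (u i)) uc := fun u uc huc x => by
    rw [SchwartzMap.tensorFin_apply]
    exact Finset.prod_congr rfl fun i _ => by rw [huc i]
  refine ⟨ofRealTest f, ofRealTest g, ofRealTest h,
    SchwartzMap.tensorFin 3 fun i => ofRealTest ((![f, g, h] : Fin 3 → _) i),
    SchwartzMap.tensorFin 2 fun i => ofRealTest ((![g, h] : Fin 2 → _) i),
    SchwartzMap.tensorFin 2 fun i => ofRealTest ((![f, h] : Fin 2 → _) i),
    SchwartzMap.tensorFin 2 fun i => ofRealTest ((![f, g] : Fin 2 → _) i),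
    SchwartzMap.tensorFin 1 fun i => ofRealTest ((![f] : Fin 1 → _) i),
    SchwartzMap.tensorFin 1 fun i => ofRealTest ((![g] : Fin 1 → _) i),
    SchwartzMap.tensorFin 1 fun i => ofRealTest ((![h] : Fin 1 → _) i),
    hT _ _ fun i => ?_, h3off, hT _ _ fun i => ?_, hT _ _ fun i => ?_, hT _ _ fun i => ?_,
    hT _ _ fun i => ?_, hT _ _ fun i => ?_, hT _ _ fun i => ?_, ?_⟩
  all_goals first | (fin_cases i <;> rfl) | exact hne

/-! ## §2 The split glue (kernel-checked) -/

/-- **`FourMirrorsWardE1.HonestLatticeLimit` from LCR + T + HYP** (the crux of item stmt-QuantumFields-18092 BY NAME):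
the Cauchy ladder of `GapBuysCauchyRate.LadderCauchyRate`, the calibrated k-uniform E0′ bound and the asymptotic
hypercubic remnant are jointly sufficient for the existence half of QCD.  [folklore] (OS-II §4 / Glimm–Jaffe §6.1
bookkeeping over the landed lattice-package toolkit; see the module docstring). -/
theorem honestLatticeLimit_of_ladderCauchyRate_of_tightness_of_remnant
    (hL : ∀ Nf : ℕ, Nf = 2 ∨ Nf = 3 → ∃ reg : QCDRegularisation Nf, reg.HasMassScaling ∧ (reg.scheme 0 0 0).HasAsymptoticScaling ∧ ∃ (𝒞 : CalibratedSpeciesFamily reg) (r : ℕ → ℝ), (Summable r ∧ reg.IsChiralAtZero) ∧ ∀ m : Fin Nf → ℝ, (∀ f, 0 < m f) → (∀ fl : Fin Nf, ∀ᶠ k in Filter.atTop, -1 < (𝒞.scheme m).mq fl k) ∧ (∃ Δ > 0, (𝒞.scheme m).HasLatticeMassGap Δ) ∧ (∀ᶠ k in Filter.atTop, (𝒞.scheme m).twoPoint k QCDField.glue QCDField.glue (thetaTest 4 𝒞.f₀) 𝒞.f₀ = 1) ∧ (∀ f g : Fin Nf, f ≠ g → ∀ᶠ k in Filter.atTop,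 (𝒞.scheme m).twoPoint k (QCDField.pseudoRe f g) (QCDField.pseudoRe f g) (thetaTest 4 𝒞.f₀) 𝒞.f₀ = 1) ∧ (∃ f g h : SchwartzMap (EuclideanSpace ℝ (Fin 4)) ℝ, tsupport (f : EuclideanSpace ℝ (Fin 4) → ℝ) ⊆ {x | x 0 < 0} ∧ tsupport (g : EuclideanSpace ℝ (Fin 4) → ℝ) ⊆ {x | 0 < x 0 ∧ x 0 < 1} ∧ tsupport (h : EuclideanSpace ℝ (Fin 4) → ℝ) ⊆ {x | 1 < x 0} ∧ ∃ ε > (0 : ℝ), ∀ᶠ k in Filter.atTop, ε ≤ ‖qcdLatticeSchwinger (𝒞.scheme m) k 3 ![QCDField.glue, QCDField.glue, QCDField.glue] ![f, g, h] - qcdLatticeSchwinger (𝒞.scheme m) k 1 ![QCDField.glue] ![f] * qcdLatticeSchwinger (𝒞.scheme m) k 2 ![QCDField.glue, QCDField.glue] ![g, h] - qcdLatticeSchwinger (𝒞.scheme m) k 1 ![QCDField.glue] ![g] * qcdLatticeSchwinger (𝒞.scheme m) k 2 ![QCDField.glue, QCDField.glue] ![f, h] - qcdLatticeSchwinger (𝒞.scheme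 m) k 1 ![QCDField.glue] ![h] * qcdLatticeSchwinger (𝒞.scheme m) k 2 ![QCDField.glue, QCDField.glue] ![f, g] + 2 * (qcdLatticeSchwinger (𝒞.scheme m) k 1 ![QCDField.glue] ![f] * qcdLatticeSchwinger (𝒞.scheme m) k 1 ![QCDField.glue] ![g] * qcdLatticeSchwinger (𝒞.scheme m) k 1 ![QCDField.glue] ![h])‖) ∧ ∀ n : ℕ, n ≠ 0 → ∀ (σ : Fin n → QCDField Nf) (f : Fin n → SchwartzMap (EuclideanSpace ℝ (Fin 4)) ℝ) (F : SchwartzMap (Fin n → EuclideanSpace ℝ (Fin 4)) ℂ), IsTensorOf F (fun i => ofRealTest (f i)) → IsOffDiagonal F → ∃ C : ℝ, ∀ k : ℕ, ‖qcdLatticeSchwinger (𝒞.scheme m) (k + 1) n σ f - qcdLatticeSchwinger (𝒞.scheme m) k n σ f‖ ≤ C * r k)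
    (hT : ∀ (Nf : ℕ) (reg : QCDRegularisation Nf) (𝒞 : CalibratedSpeciesFamily reg) (m : Fin Nf → ℝ), (∀ f, 0 < m f) → (𝒞.scheme m).HasAsymptoticScaling → (∀ fl : Fin Nf, ∀ᶠ k in Filter.atTop, -1 < (𝒞.scheme m).mq fl k) → (∃ Δ > 0, (𝒞.scheme m).HasLatticeMassGap Δ) → (∀ᶠ k in Filter.atTop, (𝒞.scheme m).twoPoint k QCDField.glue QCDField.glue (thetaTest 4 𝒞.f₀) 𝒞.f₀ = 1) → (∀ f g : Fin Nf, f ≠ g → ∀ᶠ k in Filter.atTop, (𝒞.scheme m).twoPoint k (QCDField.pseudoRe f g) (QCDField.pseudoRe f g) (thetaTest 4 𝒞.f₀) 𝒞.f₀ = 1) → (∀ n : ℕ, n ≠ 0 → ∀ (σ : Fin n → QCDField Nf) (f : Fin n → SchwartzMap (EuclideanSpace ℝ (Fin 4)) ℝ) (F : SchwartzMap (Fin n → EuclideanSpace ℝ (Fin 4)) ℂ), IsTensorOf F (fun i => ofRealTest (f i)) → IsOffDiagonal F → ∃ c : ℂ, Filter.Tendsto (fun k : ℕ => qcdLatticeSchwinger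 (𝒞.scheme m) k n σ f) Filter.atTop (nhds c)) → ∃ (s : ℕ) (α β : ℝ), 0 ≤ α ∧ (∀ (n : ℕ) (σ : Fin n → QCDField Nf), ∀ᶠ k in Filter.atTop, ∀ F : SchwartzMap (Fin n → EuclideanSpace ℝ (Fin 4)) ℂ, IsOffDiagonal F → ‖qcdLatticeDist (𝒞.scheme m) k n σ F‖ ≤ α * (n.factorial : ℝ) ^ β * schwartzNorm (n * s) F))
    (hH : ∀ (Nf : ℕ) (reg : QCDRegularisation Nf) (𝒞 : CalibratedSpeciesFamily reg) (m : Fin Nf → ℝ), (∀ f, 0 < m f) → (𝒞.scheme m).HasAsymptoticScaling → (∀ fl : Fin Nf, ∀ᶠ k in Filter.atTop, -1 < (𝒞.scheme m).mq fl k) → (∃ Δ > 0, (𝒞.scheme m).HasLatticeMassGap Δ) → (∀ᶠ k in Filter.atTop, (𝒞.scheme m).twoPoint k QCDField.glue QCDField.glue (thetaTest 4 𝒞.f₀) 𝒞.f₀ = 1) → (∀ f g : Fin Nf, f ≠ g → ∀ᶠ k in Filter.atTop, (𝒞.scheme m).twoPoint k (QCDField.pseudoRe f g) (QCDField.pseudoRe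 f g) (thetaTest 4 𝒞.f₀) 𝒞.f₀ = 1) → (∀ n : ℕ, n ≠ 0 → ∀ (σ : Fin n → QCDField Nf) (f : Fin n → SchwartzMap (EuclideanSpace ℝ (Fin 4)) ℝ) (F : SchwartzMap (Fin n → EuclideanSpace ℝ (Fin 4)) ℂ), IsTensorOf F (fun i => ofRealTest (f i)) → IsOffDiagonal F → ∃ c : ℂ, Filter.Tendsto (fun k : ℕ => qcdLatticeSchwinger (𝒞.scheme m) k n σ f) Filter.atTop (nhds c)) → ∀ (s : ℕ) (α β : ℝ), 0 ≤ α → (∀ (n : ℕ) (σ : Fin n → QCDField Nf), ∀ᶠ k in Filter.atTop, ∀ F : SchwartzMap (Fin n → EuclideanSpace ℝ (Fin 4)) ℂ, IsOffDiagonal F → ‖qcdLatticeDist (𝒞.scheme m) k n σ F‖ ≤ α * (n.factorial : ℝ) ^ β * schwartzNorm (n * s) F) → (∀ (n : ℕ) (σ : Fin n → QCDField Nf) (R : EuclideanSpace ℝ (Fin 4) ≃ₗᵢ[ℝ] EuclideanSpace ℝ (Fin 4)), LinearMap.det (R.toLinearEquiv : EuclideanSpace ℝ (Fin 4) →ₗ[ℝ]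 EuclideanSpace ℝ (Fin 4)) = 1 → (∀ i : Fin 4, ∃ j : Fin 4, R (EuclideanSpace.single i 1) = EuclideanSpace.single j 1 ∨ R (EuclideanSpace.single i 1) = -EuclideanSpace.single j 1) → ∀ F : SchwartzMap (Fin n → EuclideanSpace ℝ (Fin 4)) ℂ, IsOffDiagonal F → Filter.Tendsto (fun k : ℕ => qcdLatticeDist (𝒞.scheme m) k n σ (linActMulti R F) - qcdLatticeDist (𝒞.scheme m) k n σ F) Filter.atTop (nhds 0))) :
    Summit.QuantumFields.QCD.Theses.FourMirrorsWardE1.HonestLatticeLimit := by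
  unfold Summit.QuantumFields.QCD.Theses.FourMirrorsWardE1.HonestLatticeLimit
  dsimp only
  intro Nf hNf
  obtain ⟨reg, hms, hAS, 𝒞, r, ⟨hr, hchi⟩, H⟩ := hL Nf hNf
  refine ⟨reg, hms, hchi, fun m hm => ?_⟩
  obtain ⟨hbr, hgapE, hcalg, hcalp, hκ₃, hCauchy⟩ := H m hm
  -- (1) convergence of the honest lattice `n`-point functions on off-diagonal real tensors (Cauchy + summable)
  have hLIM : ∀ n : ℕ, n ≠ 0 → ∀ (σ : Fin n → QCDField Nf) (f : Fin n → 𝓢((EuclideanSpace ℝ (Fin 4)), ℝ)) (F : 𝓢((Fin n → (EuclideanSpace ℝ (Fin 4))), ℂ)),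
      IsTensorOf F (fun i => ofRealTest (f i)) → IsOffDiagonal F →
        ∃ c : ℂ, Filter.Tendsto (fun k : ℕ => qcdLatticeSchwinger (𝒞.scheme m) k n σ f) Filter.atTop (nhds c) := by
    intro n hn σ f F hF hoff
    obtain ⟨C, hC⟩ := hCauchy n hn σ f F hF hoff
    exact Summit.QuantumFields.QCD.Theorems.cauchySummation_proof _ r C hr hC
  -- asymptotic scaling reads only `β`, `a`
  have hASm : (𝒞.scheme m).HasAsymptoticScaling := hAS
  -- (2) tightness (stub T), asymptotic translations (landed AT), the discrete remnant (stub HYP)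
  obtain ⟨s, α, β, hα, hb⟩ := hT Nf reg 𝒞 m hm hASm hbr hgapE hcalg hcalp hLIM
  have hP6 := Summit.QuantumFields.QCD.Theorems.ConvergentOSClosure.stub_asymptoticTranslation
    Nf reg 𝒞 m hm hASm hbr hgapE hcalg hcalp hLIM s α β hα hb
  have hP7 := hH Nf reg 𝒞 m hm hASm hbr hgapE hcalg hcalp hLIM s α β hα hb
  -- (3) convergence on all of `⁰𝒮` and the limit family
  have hconv : ∀ (n : ℕ) (σ : Fin n → QCDField Nf) (F : 𝓢((Fin n → (EuclideanSpace ℝ (Fin 4))), ℂ)),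
      IsOffDiagonal F → ∃ c : ℂ, Tendsto (fun k => qcdLatticeDist (𝒞.scheme m) k n σ F) atTop (𝓝 c) :=
    tendsto_qcdLatticeDist_of_tensor (𝒞.scheme m) stub_offDiagonalTensorDensity hb hLIM
  obtain ⟨S, hS, hSb⟩ := exists_labelled_tendsto (fun k => qcdLatticeDist (𝒞.scheme m) k)
    (fun n => α * (n.factorial : ℝ) ^ β) (fun n => n * s) (fun n => by positivity) hb hconv
  have htensor : ∀ n : ℕ, n ≠ 0 → ∀ (σ : Fin n → QCDField Nf) (f : Fin n → 𝓢((EuclideanSpace ℝ (Fin 4)), ℝ)) (F : 𝓢((Fin n → (EuclideanSpace ℝ (Fin 4))), ℂ)),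
      IsTensorOf F (fun i => ofRealTest (f i)) → IsOffDiagonal F →
      Filter.Tendsto (fun k : ℕ => qcdLatticeSchwinger (𝒞.scheme m) k n σ f) Filter.atTop (nhds (S n σ F)) := by
    intro n hn σ f F hF hoff
    refine (hS n σ F hoff).congr' (Eventually.of_forall fun k => ?_)
    exact qcdLatticeSchwinger_eq_qcdLatticeDist (𝒞.scheme m) k n hn σ f F hF
  -- (4) the axioms of `S`
  have h0 : S.IsNormalized :=
    isNormalized_of_labelled_tendsto hS (Eventually.of_forall fun k => isNormalized_qcdLatticeDist (𝒞.scheme m) k)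
  have hE0' : S.HasLinearGrowth := hasLinearGrowth_of_labelled_bound S s α β fun n k F _ => hSb n k F
  have hE1t : ∀ (n : ℕ) (σ : Fin n → QCDField Nf) (a : (EuclideanSpace ℝ (Fin 4))) (F : 𝓢((Fin n → (EuclideanSpace ℝ (Fin 4))), ℂ)), IsOffDiagonal F →
      S n σ (translateMulti a F) = S n σ F :=
    translate_eq_of_labelled_tendsto hS hP6
  have hsymm : ∀ (n : ℕ) (σ : Fin n → QCDField Nf) (π : Equiv.Perm (Fin n)) (F : 𝓢((Fin n → (EuclideanSpace ℝ (Fin 4))), ℂ)),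
      IsOffDiagonal F →
      Tendsto (fun k => qcdLatticeDist (𝒞.scheme m) k n σ (permTest π F) -
        qcdLatticeDist (𝒞.scheme m) k n (σ ∘ π) F) atTop (𝓝 0) := by
    intro n σ π F _
    have hzero : (fun k => qcdLatticeDist (𝒞.scheme m) k n σ (permTest π F) -
        qcdLatticeDist (𝒞.scheme m) k n (σ ∘ π) F) = fun _ => 0 :=
      funext fun k => by rw [stub_permExact, sub_self]
    rw [hzero]
    exact tendsto_const_nhds
  have hE3 : S.IsSymmetric := isSymmetric_of_labelled_tendsto hS hsymm
  have hE1h : ∀ (n : ℕ) (σ : Fin n → QCDField Nf) (R : (EuclideanSpace ℝ (Fin 4)) ≃ₗᵢ[ℝ] (EuclideanSpace ℝ (Fin 4))),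
      LinearMap.det (R.toLinearEquiv : (EuclideanSpace ℝ (Fin 4)) →ₗ[ℝ] (EuclideanSpace ℝ (Fin 4))) = 1 →
      (∀ i : Fin 4, ∃ j : Fin 4, R (EuclideanSpace.single i 1) = EuclideanSpace.single j 1 ∨
        R (EuclideanSpace.single i 1) = -EuclideanSpace.single j 1) →
      ∀ F : 𝓢((Fin n → (EuclideanSpace ℝ (Fin 4))), ℂ), IsOffDiagonal F → S n σ (linActMulti R F) = S n σ F := by
    intro n σ R hdet hax F hF
    have hA : Tendsto (fun k => qcdLatticeDist (𝒞.scheme m) k n σ (linActMulti R F)) atTop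
        (𝓝 (S n σ (linActMulti R F))) := hS n σ _ (isOffDiagonal_linActMulti R hF)
    have hB : Tendsto (fun k => qcdLatticeDist (𝒞.scheme m) k n σ F) atTop (𝓝 (S n σ F)) := hS n σ F hF
    exact sub_eq_zero.1 (tendsto_nhds_unique (hA.sub hB) (hP7 n σ R hdet hax F hF))
  obtain ⟨Δ, hΔ, hgap⟩ := hgapE
  -- (5) the conclusion, in the crux's order
  refine ⟨𝒞.z m, 𝒞.shift m, S, ⟨⟨h0, hE0', hE3, hE1t, hE1h⟩, ⟨hASm, hbr, htensor⟩, Δ, hΔ, hgap⟩, ?_, ?_, ?_⟩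
  · exact nt_of_calibration 𝒞 m _ hcalg S htensor
  · exact ng_of_kappa₃ (𝒞.scheme m) _ hκ₃ S htensor
  · exact fun f g hfg => nt_of_calibration 𝒞 m _ (hcalp f g hfg) S htensor

/-- The same glue for the `TransparentRPWall` copy of the crux (identical body; definitional transport). [folklore] -/
theorem honestLatticeLimit_of_ladderCauchyRate_of_tightness_of_remnant'
    (hL : ∀ Nf : ℕ, Nf = 2 ∨ Nf = 3 → ∃ reg : QCDRegularisation Nf, reg.HasMassScaling ∧ (reg.scheme 0 0 0).HasAsymptoticScaling ∧ ∃ (𝒞 : CalibratedSpeciesFamily reg) (r : ℕ → ℝ), (Summable r ∧ reg.IsChiralAtZero) ∧ ∀ m : Fin Nf → ℝ, (∀ f, 0 < m f) → (∀ fl : Fin Nf, ∀ᶠ k in Filter.atTop, -1 < (𝒞.scheme m).mq fl k) ∧ (∃ Δ > 0, (𝒞.scheme m).HasLatticeMassGap Δ) ∧ (∀ᶠ k in Filter.atTop, (𝒞.scheme m).twoPoint k QCDField.glue QCDField.glue (thetaTest 4 𝒞.f₀) 𝒞.f₀ = 1) ∧ (∀ f g : Fin Nf, f ≠ g → ∀ᶠ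 k in Filter.atTop, (𝒞.scheme m).twoPoint k (QCDField.pseudoRe f g) (QCDField.pseudoRe f g) (thetaTest 4 𝒞.f₀) 𝒞.f₀ = 1) ∧ (∃ f g h : SchwartzMap (EuclideanSpace ℝ (Fin 4)) ℝ, tsupport (f : EuclideanSpace ℝ (Fin 4) → ℝ) ⊆ {x | x 0 < 0} ∧ tsupport (g : EuclideanSpace ℝ (Fin 4) → ℝ) ⊆ {x | 0 < x 0 ∧ x 0 < 1} ∧ tsupport (h : EuclideanSpace ℝ (Fin 4) → ℝ) ⊆ {x | 1 < x 0} ∧ ∃ ε > (0 : ℝ), ∀ᶠ k in Filter.atTop, ε ≤ ‖qcdLatticeSchwinger (𝒞.scheme m) k 3 ![QCDField.glue, QCDField.glue, QCDField.glue] ![f, g, h] - qcdLatticeSchwinger (𝒞.scheme m) k 1 ![QCDField.glue] ![f] * qcdLatticeSchwinger (𝒞.scheme m) k 2 ![QCDField.glue, QCDField.glue] ![g, h] - qcdLatticeSchwinger (𝒞.scheme m) k 1 ![QCDField.glue] ![g] * qcdLatticeSchwinger (𝒞.scheme m) k 2 ![QCDField.glue, QCDField.glue] ![f, h] - qcdLatticeSchwinger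 (𝒞.scheme m) k 1 ![QCDField.glue] ![h] * qcdLatticeSchwinger (𝒞.scheme m) k 2 ![QCDField.glue, QCDField.glue] ![f, g] + 2 * (qcdLatticeSchwinger (𝒞.scheme m) k 1 ![QCDField.glue] ![f] * qcdLatticeSchwinger (𝒞.scheme m) k 1 ![QCDField.glue] ![g] * qcdLatticeSchwinger (𝒞.scheme m) k 1 ![QCDField.glue] ![h])‖) ∧ ∀ n : ℕ, n ≠ 0 → ∀ (σ : Fin n → QCDField Nf) (f : Fin n → SchwartzMap (EuclideanSpace ℝ (Fin 4)) ℝ) (F : SchwartzMap (Fin n → EuclideanSpace ℝ (Fin 4)) ℂ), IsTensorOf F (fun i => ofRealTest (f i)) → IsOffDiagonal F → ∃ C : ℝ, ∀ k : ℕ, ‖qcdLatticeSchwinger (𝒞.scheme m) (k + 1) n σ f - qcdLatticeSchwinger (𝒞.scheme m) k n σ f‖ ≤ C * r k)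
    (hT : ∀ (Nf : ℕ) (reg : QCDRegularisation Nf) (𝒞 : CalibratedSpeciesFamily reg) (m : Fin Nf → ℝ), (∀ f, 0 < m f) → (𝒞.scheme m).HasAsymptoticScaling → (∀ fl : Fin Nf, ∀ᶠ k in Filter.atTop, -1 < (𝒞.scheme m).mq fl k) → (∃ Δ > 0, (𝒞.scheme m).HasLatticeMassGap Δ) → (∀ᶠ k in Filter.atTop, (𝒞.scheme m).twoPoint k QCDField.glue QCDField.glue (thetaTest 4 𝒞.f₀) 𝒞.f₀ = 1) → (∀ f g : Fin Nf, f ≠ g → ∀ᶠ k in Filter.atTop, (𝒞.scheme m).twoPoint k (QCDField.pseudoRe f g) (QCDField.pseudoRe f g) (thetaTest 4 𝒞.f₀) 𝒞.f₀ = 1) → (∀ n : ℕ, n ≠ 0 → ∀ (σ : Fin n → QCDField Nf) (f : Fin n → SchwartzMap (EuclideanSpace ℝ (Fin 4)) ℝ) (F : SchwartzMap (Fin n → EuclideanSpace ℝ (Fin 4)) ℂ), IsTensorOf F (fun i => ofRealTest (f i)) → IsOffDiagonal F → ∃ c : ℂ, Filter.Tendsto (fun k : ℕ => qcdLatticeSchwinger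 (𝒞.scheme m) k n σ f) Filter.atTop (nhds c)) → ∃ (s : ℕ) (α β : ℝ), 0 ≤ α ∧ (∀ (n : ℕ) (σ : Fin n → QCDField Nf), ∀ᶠ k in Filter.atTop, ∀ F : SchwartzMap (Fin n → EuclideanSpace ℝ (Fin 4)) ℂ, IsOffDiagonal F → ‖qcdLatticeDist (𝒞.scheme m) k n σ F‖ ≤ α * (n.factorial : ℝ) ^ β * schwartzNorm (n * s) F))
    (hH : ∀ (Nf : ℕ) (reg : QCDRegularisation Nf) (𝒞 : CalibratedSpeciesFamily reg) (m : Fin Nf → ℝ), (∀ f, 0 < m f) → (𝒞.scheme m).HasAsymptoticScaling → (∀ fl : Fin Nf, ∀ᶠ k in Filter.atTop, -1 < (𝒞.scheme m).mq fl k) → (∃ Δ > 0, (𝒞.scheme m).HasLatticeMassGap Δ) → (∀ᶠ k in Filter.atTop, (𝒞.scheme m).twoPoint k QCDField.glue QCDField.glue (thetaTest 4 𝒞.f₀) 𝒞.f₀ = 1) → (∀ f g : Fin Nf, f ≠ g → ∀ᶠ k in Filter.atTop, (𝒞.scheme m).twoPoint k (QCDField.pseudoRe f g) (QCDField.pseudoRe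 f g) (thetaTest 4 𝒞.f₀) 𝒞.f₀ = 1) → (∀ n : ℕ, n ≠ 0 → ∀ (σ : Fin n → QCDField Nf) (f : Fin n → SchwartzMap (EuclideanSpace ℝ (Fin 4)) ℝ) (F : SchwartzMap (Fin n → EuclideanSpace ℝ (Fin 4)) ℂ), IsTensorOf F (fun i => ofRealTest (f i)) → IsOffDiagonal F → ∃ c : ℂ, Filter.Tendsto (fun k : ℕ => qcdLatticeSchwinger (𝒞.scheme m) k n σ f) Filter.atTop (nhds c)) → ∀ (s : ℕ) (α β : ℝ), 0 ≤ α → (∀ (n : ℕ) (σ : Fin n → QCDField Nf), ∀ᶠ k in Filter.atTop, ∀ F : SchwartzMap (Fin n → EuclideanSpace ℝ (Fin 4)) ℂ, IsOffDiagonal F → ‖qcdLatticeDist (𝒞.scheme m) k n σ F‖ ≤ α * (n.factorial : ℝ) ^ β * schwartzNorm (n * s) F) → (∀ (n : ℕ) (σ : Fin n → QCDField Nf) (R : EuclideanSpace ℝ (Fin 4) ≃ₗᵢ[ℝ] EuclideanSpace ℝ (Fin 4)), LinearMap.det (R.toLinearEquiv : EuclideanSpace ℝ (Fin 4) →ₗ[ℝ]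 EuclideanSpace ℝ (Fin 4)) = 1 → (∀ i : Fin 4, ∃ j : Fin 4, R (EuclideanSpace.single i 1) = EuclideanSpace.single j 1 ∨ R (EuclideanSpace.single i 1) = -EuclideanSpace.single j 1) → ∀ F : SchwartzMap (Fin n → EuclideanSpace ℝ (Fin 4)) ℂ, IsOffDiagonal F → Filter.Tendsto (fun k : ℕ => qcdLatticeDist (𝒞.scheme m) k n σ (linActMulti R F) - qcdLatticeDist (𝒞.scheme m) k n σ F) Filter.atTop (nhds 0))) :
    Summit.QuantumFields.QCD.Theses.TransparentRPWall.HonestLatticeLimit :=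
  honestLatticeLimit_of_ladderCauchyRate_of_tightness_of_remnant hL hT hH

end Summit.QuantumFields.QCD.Theorems.HonestLatticeLimitSplit

end
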